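/-
Copyright (c) 2026 the pub-hodgecm-mathlib formalisation cell (harness21).  Prover seat hodgecm-mathlib-R90-CS-p03 (g4), Track B ∕ R90-TF, h413 = `stmt-HodgeConjecture-24833`,
R90-TF section S8 «ContSpec-n½» (S8 dealer R90-CS-plan (g4) S8-R261 (1) «W7 AT THE SOURCE»; census `R90/S8/CENSUS-hKwildLB-tauExports.R90-CS-p03-g4.md` 2dd2d92a2620bdea): ★ p865202's
wild letter (hKwildLB) «every τ-level atom is the closed span of the classes of its LOCALLY BOUNDED data» PAID FROM THE τ-EXPORTS modulo the `K_∞`-finite density letter (hDENSτ),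
and the short circuit `hW1 ⟸ (hFIN) + (hDENSτ)`.
-/
import Summits.HodgeConjecture.HodgeConjecture.Theorems.R90S8ResGMidAtomBotWildOfLocallyBoundedU3   -- ★ p865202 (this seat): `hW1_of_locallyBounded (hμu) (hFIN) (hKwildLB) (hKreg)`; brings ★ p865108, ★ p865018 `hW1_of_tauLevel_atoms_le`, ★ D1–D3, ★ τ-DEFS
import Summits.HodgeConjecture.HodgeConjecture.Theorems.R90S8KTypeCoweightLineProductU3            -- ★ p864934 (K2E1-p12 (g6)): `hEXP_tauRow_of_record` (ESTATE T's `hE4 ∧ hEbd` for the OWN continuation of every τ-admissible datum)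
import HarnessLib

/-!
# S8 (R)′ ∕ (M) ∕ (V♭) letter `hW1`, FOURTH FILE — `R90S8ResGMidAtomLocallyBoundedDataOfTauLevelU3`: τ-ADMISSIBLE data are LOCALLY BOUNDED (★ τ-exports), so (hKwildLB) is paid modulo
# the `K_∞`-finite density letter (hDENSτ); and `hW1 ⟸ (hFIN) + (hDENSτ)` directly

Track B ∕ R90-TF, crux h413 = `stmt-HodgeConjecture-24833`, route of record `HCCMUnconditional`; cell `hodgecm-mathlib`, R90-TF section S8 «ContSpec-n½», letter `hW1 : resGMidBlock ξ μω ≤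
resGMidBlockτ ξ μω` of (R)′ :337 ∕ (M) :299 ∕ (V♭) :406.  THEOREMS ONLY (no `def`, no `instance`, no `notation`, no named-fact hypothesis, no `sorry`; default heartbeats); lane
`--supports stmt-HodgeConjecture-24833 --as helper` (count-neutral).  CLOSES NO SOCKET.

THE CENSUS (S8-R261 (1) (i)–(iv)).  (i) ★ D1's τ-LEVEL generators `resGMidAtomGen ξ μω (ι_f U₀) 1` admit ANY continuous section; `K_∞`-finiteness (`IsArchFinite`) is the extra binder of the
τ-ADMISSIBLE generators ★ `resGMidAtomGenτ ξ μω U₀` only.  (ii)+(iii) For τ-admissible data nothing is left to prove: ★ `hEXP_tauRow_of_record` (K2E1-p12 (g6)) returns ESTATE T's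
`hE4 ∧ hEbd` — `g`-continuity AND the joint local bound on `{1 < Re} ∖ Sp` — for the datum's OWN continuation `Ec` (the identity-theorem and removable-pole bookkeeping is inside ESTATE T),
from `hμu` and the exports FRAME alone.  Hence (§1) every τ-admissible class is the class of a LOCALLY BOUNDED datum, and the τ-admissible atom lies in the closed span of the locally
bounded classes.  (iv) What remains of ★ p865202's (hKwildLB) is the `K_∞`-FINITE DENSITY LETTER **(hDENSτ) `resGMidAtom ξ μω (ι_f U₀) 1 ≤ resGMidAtomτ ξ μω U₀` for every τ-level `U₀`**
(«the middle-pole residue classes of the `K_∞`-finite sections at a τ-level are dense in those of all continuous sections»; [MW95 II.1, V.3.13] for smooth `K`-finite data — L, unowned):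
§2 **`hKwildLB_of_tauExports (frame) (hμu) (hDENSτ)`** in ★ `hW1_of_locallyBounded`'s bytes.  §3 records the SHORT CIRCUIT: with (hDENSτ) named, `hW1` follows from (hFIN) + (hDENSτ)
ALONE (★ `hW1_of_tauLevel_atoms_le` + ★ `resGMidAtomτ_le_resGMidBlockτ`) — the `K_∞`-type road (★ p865018 ∕ p865108 ∕ p865202, LH4-p10's (hKreg)) is then OPTIONAL for `hW1` and remains
the sharper diagnosis (its residue asks density of LOCALLY BOUNDED data only, a superset of the `K_∞`-finite data by §1).
* §1 **`tauAdmissible_classes_subset_locallyBounded_classes (frame) (hμu) (hU₀)`**, `resGMidAtomτ_le_closure_span_locallyBounded (frame) (hμu) (hU₀)`.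
* §2 **`hKwildLB_of_tauExports (frame) (hμu) (hDENSτ)`** — (hKwildLB) BYTE FOR BYTE as ★ `hW1_of_locallyBounded` binds it.
* §3 **`hW1_of_tauDensity (hFIN) (hDENSτ) : resGMidBlock L μ ξ μω ≤ resGMidBlockτ L μ ξ μω`** (frame-free, measure-free), `resGMidBlockτ_eq_resGMidBlock_of_tauDensity`.
HONEST LABEL: HC_CM is proved only modulo the 7 printed citations (2 remaining named inputs: hLiu418 = `stmt-HodgeConjecture-24832`, h413 = `stmt-HodgeConjecture-24833`) until
rung 0 closes; REL ≠ ★ ≠ BUILT; this file PAYS NO SOCKET: hW1 = ★ ∘ {(hFIN) (K2E1-p14 (g5) ★ modulo its (hAVG)), (hDENSτ) (L, UNOWNED, unprinted as typed at non-smooth data)}; count-neutral.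

## References
* [MoeglinWaldspurger1995] C. Mœglin, J.-L. Waldspurger, *Spectral Decomposition and Eisenstein Series* (1995), I.2.17, II.1, IV.1.9–IV.1.11, V.3.13.
* [BorelJacquet1979] A. Borel, H. Jacquet, *Automorphic forms and automorphic representations*, Corvallis PSPM 33.1 (1979), §4.1, §4.6.
* [Rogawski1990] J. D. Rogawski, *Automorphic Representations of Unitary Groups in Three Variables* (1990), §13.9 p. 229 (ii).
-/

set_option autoImplicit false
set_option linter.dupNamespace false  -- the mandated namespace `…HodgeConjecture.HodgeConjecture.R90.S8` (LEAD #1 L1) repeats the summit's segment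

noncomputable section

open MeasureTheory Measure Set Filter Topology NumberField ContRepresentation
open Literature.NumberTheory Literature.NumberTheory.Automorphic Literature.NumberTheory.Automorphic.UnitaryGroup Literature.NumberTheory.GaloisRepresentations AdelicGroupData
open Literature.NumberTheory.Automorphic.Arthur2013.Leaves.TECR Literature.NumberTheory.Rogawski1990
open Literature.RepresentationTheory.CompactGroups
open Summit.HodgeConjecture.HodgeConjecture.Cruxes.H413.K2E1BorelEisensteinU
open Summit.HodgeConjecture.HodgeConjecture.Cruxes.H413.K2E1ChiSectionSpaceU3PairDefs
open Summit.HodgeConjecture.HodgeConjecture.Cruxes.H413.K2E1BLBorelSpacesU2Defs Summit.HodgeConjecture.HodgeConjecture.Cruxes.H413.K2E1BLBorelOperatorsU2Defs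
open Literature.MeasureTheory.Group
open scoped ENNReal NNReal InnerProductSpace

namespace Summit.HodgeConjecture.HodgeConjecture.R90.S8

/-! ## §3 first (frame-free): the short circuit `hW1 ⟸ (hFIN) + (hDENSτ)` -/

section Short

variable (L : Type) [Field L] [NumberField L] [IsCMField L]
  (μ : Measure (quasiSplit (↥(maximalRealSubfield L)) L (IsCMField.complexConj L) 3).automorphicQuotient)
  [(quasiSplit (↥(maximalRealSubfield L)) L (IsCMField.complexConj L) 3).IsAutomorphicMeasure μ]
  (ξ : OneDimAutRepH L) (μω : HeckeCharacter L)

/-- **HEAD (SHORT CIRCUIT) — `hW1` FROM THE TWO DENSITY LETTERS ALONE**: (hFIN) «the level-free atom lies in the closure of the τ-LEVEL atoms» (K2E1-p14 (g5), ★ `hFIN_of_levelIdempotents`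
modulo (hAVG)) and **(hDENSτ)** «every τ-LEVEL atom lies in its τ-ADMISSIBLE atom» (`K_∞`-finite density of middle-pole residue classes at a fixed τ-level — L, unowned) give
`resGMidBlock L μ ξ μω ≤ resGMidBlockτ L μ ξ μω` by ★ `hW1_of_tauLevel_atoms_le` and ★ `resGMidAtomτ_le_resGMidBlockτ`.  No `K_∞`-type cut, no measure, no frame.
[cite: MoeglinWaldspurger1995, II.1, V.3.13] [cite: Rogawski1990, §13.9 p. 229 (ii)] -/
theorem hW1_of_tauDensity
    (hFIN : resGMidAtom L μ ξ μω ⊥ 1 ≤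
      (⨆ (U₀ : Subgroup ↥(finAdelic (↥(maximalRealSubfield L)) L (IsCMField.complexConj L) 3 ((StdForm.antidiagonal 3).over L))) (_ : IsTauLevel L U₀),
        resGMidAtom L μ ξ μω (tauLevel L U₀) 1).topologicalClosure)
    (hDENSτ : ∀ (U₀ : Subgroup ↥(finAdelic (↥(maximalRealSubfield L)) L (IsCMField.complexConj L) 3 ((StdForm.antidiagonal 3).over L))), IsTauLevel L U₀ →
      resGMidAtom L μ ξ μω (tauLevel L U₀) 1 ≤ resGMidAtomτ L μ ξ μω U₀) :
    resGMidBlock L μ ξ μω ≤ resGMidBlockτ L μ ξ μω :=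
  hW1_of_tauLevel_atoms_le L μ ξ μω hFIN fun U₀ hU₀ => (hDENSτ U₀ hU₀).trans (resGMidAtomτ_le_resGMidBlockτ L μ ξ μω hU₀)

/-- Under the two density letters the τ-admissible and the full middle blocks COINCIDE. [cite: MoeglinWaldspurger1995, II.1, V.3.13] -/
theorem resGMidBlockτ_eq_resGMidBlock_of_tauDensity
    (hFIN : resGMidAtom L μ ξ μω ⊥ 1 ≤
      (⨆ (U₀ : Subgroup ↥(finAdelic (↥(maximalRealSubfield L)) L (IsCMField.complexConj L) 3 ((StdForm.antidiagonal 3).over L))) (_ : IsTauLevel L U₀),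
        resGMidAtom L μ ξ μω (tauLevel L U₀) 1).topologicalClosure)
    (hDENSτ : ∀ (U₀ : Subgroup ↥(finAdelic (↥(maximalRealSubfield L)) L (IsCMField.complexConj L) 3 ((StdForm.antidiagonal 3).over L))), IsTauLevel L U₀ →
      resGMidAtom L μ ξ μω (tauLevel L U₀) 1 ≤ resGMidAtomτ L μ ξ μω U₀) :
    resGMidBlockτ L μ ξ μω = resGMidBlock L μ ξ μω :=
  le_antisymm (resGMidBlockτ_le_resGMidBlock L μ ξ μω) (hW1_of_tauDensity L μ ξ μω hFIN hDENSτ)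

end Short

/-! ## §1 τ-admissible data are locally bounded (★ `hEXP_tauRow_of_record`), §2 (hKwildLB) from (hDENSτ) -/

section Exports

variable (L : Type) [Field L] [NumberField L] [IsCMField L]
  [MeasurableSpace (quasiSplit (↥(maximalRealSubfield L)) L (IsCMField.complexConj L) 3).Adelic] [BorelSpace (quasiSplit (↥(maximalRealSubfield L)) L (IsCMField.complexConj L) 3).Adelic]
  [MeasurableSpace ↥(arch (↥(maximalRealSubfield L)) L (IsCMField.complexConj L) 3 ((StdForm.antidiagonal 3).over L))] [BorelSpace ↥(arch (↥(maximalRealSubfield L)) L (IsCMField.complexConj L) 3 ((StdForm.antidiagonal 3).over L))]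
  [MeasurableSpace ↥(finAdelic (↥(maximalRealSubfield L)) L (IsCMField.complexConj L) 3 ((StdForm.antidiagonal 3).over L))] [BorelSpace ↥(finAdelic (↥(maximalRealSubfield L)) L (IsCMField.complexConj L) 3 ((StdForm.antidiagonal 3).over L))]
  (μ : Measure (quasiSplit (↥(maximalRealSubfield L)) L (IsCMField.complexConj L) 3).automorphicQuotient) [(quasiSplit (↥(maximalRealSubfield L)) L (IsCMField.complexConj L) 3).IsAutomorphicMeasure μ]
  (νG : Measure (quasiSplit (↥(maximalRealSubfield L)) L (IsCMField.complexConj L) 3).Adelic) [νG.IsHaarMeasure] [νG.IsInvInvariant] [SFinite νG]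
  (ν : Measure ↥(adelicUnipotent (↥(maximalRealSubfield L)) L (IsCMField.complexConj L) 3)) [ν.IsHaarMeasure] [ν.IsMulRightInvariant] [ν.IsInvInvariant]
  {𝓕 : Set ↥(adelicUnipotent (↥(maximalRealSubfield L)) L (IsCMField.complexConj L) 3)}
  (h𝓕N : IsFundamentalDomain ↥(rationalUnipotent (↥(maximalRealSubfield L)) L (IsCMField.complexConj L) 3) 𝓕 ν) (h𝓕c : IsCompact (closure 𝓕)) (h𝓕₀ : ν 𝓕 ≠ 0)
  {β : (quasiSplit (↥(maximalRealSubfield L)) L (IsCMField.complexConj L) 3).Adelic → ℝ≥0∞}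
  (hβ : IsCoveringWeight ↥((arithmeticBorel (↥(maximalRealSubfield L)) L (IsCMField.complexConj L) 3).map (quasiSplit (↥(maximalRealSubfield L)) L (IsCMField.complexConj L) 3).arithmeticSubgroup.subtype) β)
  {μZ : Measure (borelQuotient (↥(maximalRealSubfield L)) L (IsCMField.complexConj L) 3)} [SFinite μZ]
  (hμZ : ∀ f : borelQuotient (↥(maximalRealSubfield L)) L (IsCMField.complexConj L) 3 → ℝ≥0∞, Measurable f → ∫⁻ z, f z ∂μZ = ∫⁻ g, β g * f (toBorelQuotient (↥(maximalRealSubfield L)) L (IsCMField.complexConj L) 3 g) ∂νG)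
  (μa : Measure ↥(arch (↥(maximalRealSubfield L)) L (IsCMField.complexConj L) 3 ((StdForm.antidiagonal 3).over L))) [μa.IsHaarMeasure] [μa.IsMulRightInvariant]
  (μf : Measure ↥(finAdelic (↥(maximalRealSubfield L)) L (IsCMField.complexConj L) 3 ((StdForm.antidiagonal 3).over L))) [μf.IsHaarMeasure]
  (ξ : OneDimAutRepH L) {μω : HeckeCharacter L}

include h𝓕N h𝓕c h𝓕₀ hβ hμZ μa μf in
/-- **§1 — EVERY τ-ADMISSIBLE CLASS IS THE CLASS OF A LOCALLY BOUNDED DATUM**: `resGMidAtomGenτ ξ μω U₀ ⊆ {classes of locally bounded data at (ι_f U₀, 1)}` (the set-builder of ★ p865202's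
(hKwildLB)): the datum of a τ-admissible generator is its own witness, its continuation `Ec` being jointly locally bounded on `{1 < Re} ∖ Sp` by ★ `hEXP_tauRow_of_record` (.2) — from
`hμu` and the exports FRAME. [cite: MoeglinWaldspurger1995, IV.1.9–IV.1.11] [cite: Rogawski1990, §13.9 p. 229 (ii)] -/
theorem tauAdmissible_classes_subset_locallyBounded_classes (hμu : μω.IsUnitary)
    (U₀ : Subgroup ↥(finAdelic (↥(maximalRealSubfield L)) L (IsCMField.complexConj L) 3 ((StdForm.antidiagonal 3).over L))) (hU₀ : IsTauLevel L U₀) :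
    resGMidAtomGenτ L μ ξ μω U₀ ⊆
    {f : (quasiSplit (↥(maximalRealSubfield L)) L (IsCMField.complexConj L) 3).L2 μ |
      ∃ (φ : (quasiSplit (↥(maximalRealSubfield L)) L (IsCMField.complexConj L) 3).Adelic → ℂ)
        (_ : φ ∈ chiSectionSpacePair (ξ.bcη⁻¹ * ξ.bcψ⁻¹ * μω) ξ.ψ (tauLevel L U₀) ((1 : ↥(tauLevel L U₀) →* ℂ) : ↥(tauLevel L U₀) → ℂ)) (_ : Continuous φ)
        (Ec : ℂ → (quasiSplit (↥(maximalRealSubfield L)) L (IsCMField.complexConj L) 3).Adelic → ℂ) (Sp : Finset ℂ)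
        (_ : ∀ s ∈ Sp, s.im = 0 ∧ 1 < s.re ∧ s.re ≤ 2)
        (_ : ∀ g, DifferentiableOn ℂ (fun z => Ec z g) ({z : ℂ | 1 < z.re} \ (↑Sp : Set ℂ)))
        (_ : ∀ z₁ ∈ ({z : ℂ | 1 < z.re} \ (↑Sp : Set ℂ)), ∀ S : Set (quasiSplit (↥(maximalRealSubfield L)) L (IsCMField.complexConj L) 3).Adelic, IsCompact S → ∃ V ∈ 𝓝 z₁, ∃ M : ℝ, ∀ z ∈ V, ∀ g ∈ S, ‖Ec z g‖ ≤ M)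
        (_ : ∀ z : ℂ, 2 < z.re → Ec z = eisensteinSeriesU (flatSectionU φ z))
        (Fp : (quasiSplit (↥(maximalRealSubfield L)) L (IsCMField.complexConj L) 3).Adelic → ℂ → ℂ)
        (_ : ∀ g, AnalyticAt ℂ (Fp g) ((3 : ℂ) / 2))
        (_ : ∀ g, Fp g =ᶠ[𝓝[≠] ((3 : ℂ) / 2)] fun z => (z - (3 : ℂ) / 2) * Ec z g),
        (f : (quasiSplit (↥(maximalRealSubfield L)) L (IsCMField.complexConj L) 3).automorphicQuotient → ℂ) =ᵐ[μ]
          fun x => Fp (Quotient.out (x : (quasiSplit (↥(maximalRealSubfield L)) L (IsCMField.complexConj L) 3).Adelic ⧸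
            (quasiSplit (↥(maximalRealSubfield L)) L (IsCMField.complexConj L) 3).quotientSubgroup))⁻¹ ((3 : ℂ) / 2)} := by
  rintro f ⟨φ, hφV, hφc, hfin, Ec, Sp, hSp, hol, hEc2, Fp, hFp, hFpE, hae⟩
  exact ⟨φ, hφV, hφc, Ec, Sp, hSp, hol, (hEXP_tauRow_of_record L μ νG ν h𝓕N h𝓕c h𝓕₀ hβ hμZ μa μf ξ μω hμu U₀ hU₀ φ hφV hφc hfin Ec Sp hSp hol hEc2 Fp hFp hFpE f hae).2,
    hEc2, Fp, hFp, hFpE, hae⟩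

include h𝓕N h𝓕c h𝓕₀ hβ hμZ μa μf in
/-- **§1 — THE τ-ADMISSIBLE ATOM LIES IN THE CLOSED SPAN OF THE LOCALLY BOUNDED CLASSES** (closed span is monotone). [cite: MoeglinWaldspurger1995, IV.1.11, V.3.13] -/
theorem resGMidAtomτ_le_closure_span_locallyBounded (hμu : μω.IsUnitary)
    (U₀ : Subgroup ↥(finAdelic (↥(maximalRealSubfield L)) L (IsCMField.complexConj L) 3 ((StdForm.antidiagonal 3).over L))) (hU₀ : IsTauLevel L U₀) :
    resGMidAtomτ L μ ξ μω U₀ ≤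
      (Submodule.span ℂ {f : (quasiSplit (↥(maximalRealSubfield L)) L (IsCMField.complexConj L) 3).L2 μ |
          ∃ (φ : (quasiSplit (↥(maximalRealSubfield L)) L (IsCMField.complexConj L) 3).Adelic → ℂ)
            (_ : φ ∈ chiSectionSpacePair (ξ.bcη⁻¹ * ξ.bcψ⁻¹ * μω) ξ.ψ (tauLevel L U₀) ((1 : ↥(tauLevel L U₀) →* ℂ) : ↥(tauLevel L U₀) → ℂ)) (_ : Continuous φ)
            (Ec : ℂ → (quasiSplit (↥(maximalRealSubfield L)) L (IsCMField.complexConj L) 3).Adelic → ℂ) (Sp : Finset ℂ)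
            (_ : ∀ s ∈ Sp, s.im = 0 ∧ 1 < s.re ∧ s.re ≤ 2)
            (_ : ∀ g, DifferentiableOn ℂ (fun z => Ec z g) ({z : ℂ | 1 < z.re} \ (↑Sp : Set ℂ)))
            (_ : ∀ z₁ ∈ ({z : ℂ | 1 < z.re} \ (↑Sp : Set ℂ)), ∀ S : Set (quasiSplit (↥(maximalRealSubfield L)) L (IsCMField.complexConj L) 3).Adelic, IsCompact S → ∃ V ∈ 𝓝 z₁, ∃ M : ℝ, ∀ z ∈ V, ∀ g ∈ S, ‖Ec z g‖ ≤ M)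
            (_ : ∀ z : ℂ, 2 < z.re → Ec z = eisensteinSeriesU (flatSectionU φ z))
            (Fp : (quasiSplit (↥(maximalRealSubfield L)) L (IsCMField.complexConj L) 3).Adelic → ℂ → ℂ)
            (_ : ∀ g, AnalyticAt ℂ (Fp g) ((3 : ℂ) / 2))
            (_ : ∀ g, Fp g =ᶠ[𝓝[≠] ((3 : ℂ) / 2)] fun z => (z - (3 : ℂ) / 2) * Ec z g),
            (f : (quasiSplit (↥(maximalRealSubfield L)) L (IsCMField.complexConj L) 3).automorphicQuotient → ℂ) =ᵐ[μ]
              fun x => Fp (Quotient.out (x : (quasiSplit (↥(maximalRealSubfield L)) L (IsCMField.complexConj L) 3).Adelic ⧸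
                (quasiSplit (↥(maximalRealSubfield L)) L (IsCMField.complexConj L) 3).quotientSubgroup))⁻¹ ((3 : ℂ) / 2)}).topologicalClosure := by
  rw [resGMidAtomτ_def]
  exact Submodule.topologicalClosure_mono (Submodule.span_mono (tauAdmissible_classes_subset_locallyBounded_classes L μ νG ν h𝓕N h𝓕c h𝓕₀ hβ hμZ μa μf ξ hμu U₀ hU₀))

include h𝓕N h𝓕c h𝓕₀ hβ hμZ μa μf in
/-- **§2 HEAD — `hKwildLB_of_tauExports`: ★ p865202's wild letter (hKwildLB) PAID FROM THE τ-EXPORTS modulo the `K_∞`-finite density letter (hDENSτ)** «every τ-LEVEL atom lies in its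
τ-ADMISSIBLE atom» (L, unowned — census (iv)): (hDENSτ) then §1.  Conclusion BYTE FOR BYTE as ★ `hW1_of_locallyBounded` binds `hKwildLB`.
[cite: MoeglinWaldspurger1995, II.1, IV.1.9–IV.1.11, V.3.13] [cite: Rogawski1990, §13.9 p. 229 (ii)] -/
theorem hKwildLB_of_tauExports (hμu : μω.IsUnitary)
    (hDENSτ : ∀ (U₀ : Subgroup ↥(finAdelic (↥(maximalRealSubfield L)) L (IsCMField.complexConj L) 3 ((StdForm.antidiagonal 3).over L))), IsTauLevel L U₀ →
      resGMidAtom L μ ξ μω (tauLevel L U₀) 1 ≤ resGMidAtomτ L μ ξ μω U₀) :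
    ∀ (U₀ : Subgroup ↥(finAdelic (↥(maximalRealSubfield L)) L (IsCMField.complexConj L) 3 ((StdForm.antidiagonal 3).over L))) (_ : IsTauLevel L U₀),
      resGMidAtom L μ ξ μω (tauLevel L U₀) 1 ≤
        (Submodule.span ℂ {f : (quasiSplit (↥(maximalRealSubfield L)) L (IsCMField.complexConj L) 3).L2 μ |
          ∃ (φ : (quasiSplit (↥(maximalRealSubfield L)) L (IsCMField.complexConj L) 3).Adelic → ℂ)
            (_ : φ ∈ chiSectionSpacePair (ξ.bcη⁻¹ * ξ.bcψ⁻¹ * μω) ξ.ψ (tauLevel L U₀) ((1 : ↥(tauLevel L U₀) →* ℂ) : ↥(tauLevel L U₀) → ℂ)) (_ : Continuous φ)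
            (Ec : ℂ → (quasiSplit (↥(maximalRealSubfield L)) L (IsCMField.complexConj L) 3).Adelic → ℂ) (Sp : Finset ℂ)
            (_ : ∀ s ∈ Sp, s.im = 0 ∧ 1 < s.re ∧ s.re ≤ 2)
            (_ : ∀ g, DifferentiableOn ℂ (fun z => Ec z g) ({z : ℂ | 1 < z.re} \ (↑Sp : Set ℂ)))
            (_ : ∀ z₁ ∈ ({z : ℂ | 1 < z.re} \ (↑Sp : Set ℂ)), ∀ S : Set (quasiSplit (↥(maximalRealSubfield L)) L (IsCMField.complexConj L) 3).Adelic, IsCompact S → ∃ V ∈ 𝓝 z₁, ∃ M : ℝ, ∀ z ∈ V, ∀ g ∈ S, ‖Ec z g‖ ≤ M)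
            (_ : ∀ z : ℂ, 2 < z.re → Ec z = eisensteinSeriesU (flatSectionU φ z))
            (Fp : (quasiSplit (↥(maximalRealSubfield L)) L (IsCMField.complexConj L) 3).Adelic → ℂ → ℂ)
            (_ : ∀ g, AnalyticAt ℂ (Fp g) ((3 : ℂ) / 2))
            (_ : ∀ g, Fp g =ᶠ[𝓝[≠] ((3 : ℂ) / 2)] fun z => (z - (3 : ℂ) / 2) * Ec z g),
            (f : (quasiSplit (↥(maximalRealSubfield L)) L (IsCMField.complexConj L) 3).automorphicQuotient → ℂ) =ᵐ[μ]
              fun x => Fp (Quotient.out (x : (quasiSplit (↥(maximalRealSubfield L)) L (IsCMField.complexConj L) 3).Adelic ⧸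
                (quasiSplit (↥(maximalRealSubfield L)) L (IsCMField.complexConj L) 3).quotientSubgroup))⁻¹ ((3 : ℂ) / 2)}).topologicalClosure :=
  fun U₀ hU₀ => (hDENSτ U₀ hU₀).trans (resGMidAtomτ_le_closure_span_locallyBounded L μ νG ν h𝓕N h𝓕c h𝓕₀ hβ hμZ μa μf ξ hμu U₀ hU₀)

end Exports

end Summit.HodgeConjecture.HodgeConjecture.R90.S8

end
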